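import Summits.BirchSwinnertonDyer.Rank1Residual.Additive.DefectCountFiniteLevel
import Summits.BirchSwinnertonDyer.Rank1Residual.Additive.KummerLevelStabilisation
import Summits.BirchSwinnertonDyer.Rank1Residual.Additive.KummerLineTransverseDual
import Summits.BirchSwinnertonDyer.Rank1Residual.Additive.RankOneKummerInputs
import Summits.BirchSwinnertonDyer.Rank1Residual.Additive.LocalKummerOrder
import HarnessLib

/-!
# The count (C) at finite level FROM RANK-ONE INPUTS: files 63–67 combined — every hypothesis is now
# a standard Mordell–Weil / `Ш` / local-points statement (cell `b2b-bsdres`, CLASS-CLOSURE lane,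
# class O10 — x1b GEN 37, class lead; file 68 of the series)

HONEST FRAMING (cell `b2b-bsdres`, run/shared/lean/b2b/bsd-rank1-residual/, verbatim in every
file): the goal of the cell is to DELETE the COMBINATION-SHAPED residual classes of the
Birch–Swinnerton-Dyer formula for ALL analytic-rank `≤ 1` elliptic curves over `ℚ` — "full BSD
formula for every rank `≤ 1` curve in class `C`" assembled STRICTLY from published theorems — so
that the rank-`≤ 1` remainder becomes exactly the CONSTRUCTION-SHAPED classes, which are TYPED
(missing-input `Prop`s), NOT attempted. This is not "finishing BSD". CLASS-CLOSURE lane: prove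
what is provable now; shrink each hard class to its core with data; no claim beyond stated classes;
research routes on CONSTRUCTION-SHAPED X12 / O10; census / instrument output = EVIDENCE / conjecture
items, NEVER a Literature fact; `RESIDUAL-MAP.md` marks change only by signed lines. THIS FILE:
TOOL THEOREMS ONLY — no definition, no named Literature fact, no Summits-side fact `def … : Prop`,
no `sorry`, axioms standard; CONDITIONAL (hypotheses) on a Poitou–Tate family (`IsPerfect`,
`SumLocalTermEqZero`, `SelmerComplement` — the property list of the tree's named fact
`poitouTate_selmerStructure_duality`), the residual self-duality of the Kummer structure (`hsd`),
the relaxed/strict count at `v₀` (`hcount`), and the rank-one / `Ш` / local-point inputs listed below;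
nothing is booked; no label / mark / count / sub-cell moves; (C1_η), (C2_η-GZ), (C3_η) stay typed as
filed (cc-typer-6's pen); O10 stays OPEN / CONSTRUCTION-SHAPED; nothing about `BSD(W, p)` of any pair
is claimed.

## What

**`relIndex_mul_prime_pow_eq_of_rankOne`** — file 63's count
`[H¹_𝓖 : H¹_{𝓚[v₀ ↦ 0]}] · p^{m−t−ν} = #(p^t·C) · ∏_{ℓ∈T} [𝓖_ℓ : 𝓚_ℓ]` with its inputs (ii)–(v)
DISCHARGED by files 64–67, i.e. under: (MW) a point `P ∈ E(K)` generating `E(K)/p^m E(K)` and of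
order `p^m` there; (Ш) `Ш(E/K)[p^m] ⊆ Ш(E/K)[p^e]`; (Γ) `E[p^∞]^{Γ_K} = 0`; (loc) `(W⁄K_{v₀})(K_{v₀})`
has no `p`-torsion and `P` has exact `p`-divisibility level `ν` there; (span) `C ⊔ 𝓚_{v₀} = ⊤`
(⟸ transversality + B3 + Tate, file 65 `_of_card`); (kill) `p^{m−t−ν}` kills `𝓚_{m,ℓ}` at `ℓ ∈ T`;
`ν + e ≤ t`, `t + ν ≤ m`, `1 ≤ m`.  In (C): `K = ℚ`, `W` the `p*`-twist, `v₀ = p`, `P` a generator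
mod torsion (rank one, `E(ℚ)[p] = 0`), `e = exp Ш[p^∞]` (finite: Gross–Zagier–Kolyvagin),
`C = C_m`, `𝓖_ℓ = 𝒦_{m,ℓ}`.

NOT here: the bridge `H¹_𝓖 ≅ A₀`, `H¹_𝓕 ≅ S₀`; input (i) `hcount = p^m` over `ℚ`; B3.

References: [GreenbergLNM1716] §4 (pp. 98–103); [Howard2004HeegnerKolyvagin] Thm. 2.1.11;
[MilneADT2006] I Thm. 4.10, §6; [SilvermanAEC2009] VIII.§2, X.§4; [Kobayashi2003] Thm. 6.2, 9.3.
-/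

noncomputable section

open scoped Classical

universe u

open CategoryTheory Field Function NumberField IsDedekindDomain WeierstrassCurve
open Literature.NumberTheory.EllipticCurves
open Literature.NumberTheory.GaloisRepresentations
open Literature.NumberTheory.GaloisRepresentations.DiscreteGaloisModule (mu MuCarrier SelmerStructure
  localTatePairingZMod tateDual localMap)
open Literature.NumberTheory.GaloisCohomology
open Summit.BirchSwinnertonDyer.Rank1Residual.X11b.LocBridge
open Summit.BirchSwinnertonDyer.Rank1Residual.X11b.Levels
open Summit.BirchSwinnertonDyer.Rank1Residual.X5.SelfDualCount
open Summit.BirchSwinnertonDyer.Rank1Residual.Additive.StabilisedDualTransport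
open scoped ContRepresentation

namespace Summit.BirchSwinnertonDyer.Rank1Residual.Additive.DefectCountFiniteLevel

variable {K : Type u} [Field K] [NumberField K] (W : WeierstrassCurve K) (n : ℕ) [NeZero n]
  [W.IsElliptic] [Finite (geomTorsion W n)]
variable (e : geomTorsion W n → geomTorsion W n → AlgebraicClosure K)
  (hμ : ∀ S T, e S T ^ n = 1)
  (hadd₁ : ∀ S₁ S₂ T, e (S₁ + S₂) T = e S₁ T * e S₂ T)
  (hadd₂ : ∀ S T₁ T₂, e S (T₁ + T₂) = e S T₁ * e S T₂)
  (hgal : ∀ (σ : absoluteGaloisGroup K) (S T : geomTorsion W n), σ • e S T = e (σ • S) (σ • T))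
  (hnondeg : ∀ T, (∀ S, e S T = 1) → T = 0)
  (inv : LocalInvariants K n)

include hnondeg in
/-- **THE COUNT (C) AT FINITE LEVEL FROM RANK-ONE INPUTS.**  Setting of file 63 (`E/K` elliptic,
`n = p^m`, `𝓚` the Kummer structure unramified outside `S` and residually self-dual, a Poitou–Tate
family, `w₀ ∈ S`, `T ⊆ S ∖ {w₀}`, `𝓖 = 𝓚[v₀ ↦ p^t·C][ℓ ↦ 𝓖_ℓ ⊇ 𝓚_ℓ]`, `R = H¹_{𝓚[v₀ ↦ ⊤]}`, the
relaxed/strict count (i) `[R : H¹_{𝓚[v₀ ↦ 0]}] = p^m`), with inputs (ii)–(v) replaced by: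
(MW) `P ∈ E(K)` with every `Q ∈ E(K)` ≡ `a·P` mod `p^m E(K)` and `a·P ∈ p^m E(K) ⟹ p^m ∣ a`;
(Ш) `Ш(E/K)[p^m] ⊆ Ш(E/K)[p^e]`; (Γ) `E[p^∞]^{Γ_K} = 0`; (loc) no `p`-torsion in `(W⁄K_{v₀})(K_{v₀})`,
`P_{v₀} = p^ν Q`, `P_{v₀} ∉ p^{ν+1}(W⁄K_{v₀})(K_{v₀})`; (span) `C ⊔ 𝓚_{v₀} = ⊤`; (kill) `p^{m−t−ν}`
kills `𝓚_{m,ℓ}` for `ℓ ∈ T`; `ν + e ≤ t`, `t + ν ≤ m`, `1 ≤ m`.  THEN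
**`[H¹_𝓖 : H¹_{𝓚[v₀ ↦ 0]}] · p^{m−t−ν} = #(p^t·C) · ∏_{ℓ ∈ T} [𝓖_ℓ : 𝓚_ℓ]`.**
Files 63 (assembly) + 64 (idle ℓ-conditions) + 65 (transversality in dual form) + 66 (`ord κ(P)`,
`Ш`-exponent) + 67 (`ord loc_{v₀} κ(P) = p^{m−ν}`).  CONDITIONAL on the listed hypotheses; nothing booked.
[cite: GreenbergLNM1716, §4 (pp. 98–103)] [cite: Howard2004HeegnerKolyvagin, Thm. 2.1.11 (arXiv:1202.6340 p. 6)]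
[cite: SilvermanAEC2009, Thm X.4.2(a)] [cite: Kobayashi2003, Thm. 9.3 (p. 26)] -/
theorem relIndex_mul_prime_pow_eq_of_rankOne (hperf : inv.IsPerfect)
    (hvan : inv.SumLocalTermEqZero) (hcomp : inv.SelmerComplement) {S : Finset (Place K)}
    (hS : ∀ v : HeightOneSpectrum (𝓞 K), (Sum.inr v : Place K) ∉ S →
      ((n : ℕ) : 𝓞 K) ∉ v.asIdeal ∧ GaloisRep.IsUnramifiedAt v (W.torsionGaloisModule n))
    (h𝓚 : SelmerStructure.IsUnramifiedOutside (W.kummerSelmerStructure (n : ℤ) :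
      SelmerStructure (W.torsionGaloisModule n)) S)
    (hsd : ∀ v, inv.dualTransported (W.kummerSelmerStructure (n : ℤ))
      (weilDualIntertwining W n e hμ hadd₁ hadd₂ hgal) v = W.kummerSelmerStructure (n : ℤ) v)
    {w₀ : HeightOneSpectrum (𝓞 K)} (hw₀ : (Sum.inr w₀ : Place K) ∈ S)
    (T : Finset (HeightOneSpectrum (𝓞 K))) (hw₀T : w₀ ∉ T)
    (hT : ∀ w ∈ T, (Sum.inr w : Place K) ∈ S)
    (C : AddSubgroup (galoisCohomology ((W.torsionGaloisModule n).toLocal (Sum.inr w₀)) 1))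
    {p m t ν eSha : ℕ} [hp : Fact p.Prime] (hn : n = p ^ m) (hm : 1 ≤ m)
    (𝓖 : SelmerStructure (W.torsionGaloisModule n))
    (h𝓖v₀ : 𝓖 (Sum.inr w₀) = C.map (nsmulAddMonoidHom (p ^ t)))
    (h𝓖T : ∀ w ∈ T, W.kummerSelmerStructure (n : ℤ) (Sum.inr w) ≤ 𝓖 (Sum.inr w))
    (h𝓖off : ∀ v : Place K, v ≠ Sum.inr w₀ → (∀ w ∈ T, v ≠ Sum.inr w) →
      𝓖 v = W.kummerSelmerStructure (n : ℤ) v)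
    -- (i) the relaxed/strict count at `v₀`
    (hcount : (SelmerStructure.selmerGroup (Function.update (W.kummerSelmerStructure (n : ℤ))
          (Sum.inr w₀) ⊥ : SelmerStructure (W.torsionGaloisModule n))).relIndex
        (SelmerStructure.selmerGroup (Function.update (W.kummerSelmerStructure (n : ℤ))
          (Sum.inr w₀) ⊤ : SelmerStructure (W.torsionGaloisModule n))) = p ^ m)
    -- (MW)
    (hdiv : W.zsmul_geomPoints_surjective) (P : W.toAffine.Point)
    (hgen : ∀ Q : W.toAffine.Point, ∃ a : ℤ,
      Q - a • P ∈ (zsmulAddGroupHom (n : ℤ) : W.toAffine.Point →+ _).range)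
    (hord : ∀ a : ℤ, a • P ∈ (zsmulAddGroupHom (n : ℤ) : W.toAffine.Point →+ _).range →
      (n : ℤ) ∣ a)
    -- (Ш)
    (hSha : ∀ c ∈ W.sha, (n : ℤ) • c = 0 → p ^ eSha • c = 0)
    -- (Γ)
    (hΓ : ∀ Q : W.geomPrimaryTorsion p,
      (∀ σ : absoluteGaloisGroup K, X11b.LocBridge.primaryGaloisModule W p σ Q = Q) → Q = 0)
    -- (loc) at `v₀`
    [CharZero (Place.Completion (Sum.inr w₀ : Place K))]
    (htors : ∀ X : (W.baseChange (Place.Completion (Sum.inr w₀ : Place K))).toAffine.Point,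
      p • X = 0 → X = 0)
    {Qv : (W.baseChange (Place.Completion (Sum.inr w₀ : Place K))).toAffine.Point}
    (hPQ : p ^ ν • Qv = Affine.Point.baseChange (W' := W) K (Place.Completion (Sum.inr w₀ : Place K)) P)
    (hexact : ∀ Q' : (W.baseChange (Place.Completion (Sum.inr w₀ : Place K))).toAffine.Point,
      p ^ (ν + 1) • Q' ≠ Affine.Point.baseChange (W' := W) K (Place.Completion (Sum.inr w₀ : Place K)) P)
    -- (span) at `v₀`
    (hCL : C ⊔ W.kummerSelmerStructure (n : ℤ) (Sum.inr w₀) = ⊤)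
    -- (kill) at `ℓ ∈ T`
    (hkill : ∀ w ∈ T, ∀ x ∈ W.kummerSelmerStructure (n : ℤ) (Sum.inr w), p ^ (m - t - ν) • x = 0)
    (het : ν + eSha ≤ t) (htν : t + ν ≤ m) :
    (SelmerStructure.selmerGroup (Function.update (W.kummerSelmerStructure (n : ℤ)) (Sum.inr w₀) ⊥ :
          SelmerStructure (W.torsionGaloisModule n))).relIndex 𝓖.selmerGroup *
        p ^ (m - t - ν) =
      Nat.card (C.map (nsmulAddMonoidHom (p ^ t))) *
        ∏ w ∈ T, (W.kummerSelmerStructure (n : ℤ) (Sum.inr w)).relIndex (𝓖 (Sum.inr w)) := by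
  subst hn
  have hnz : (((p ^ m : ℕ) : ℤ)) ≠ 0 := by exact_mod_cast pow_ne_zero m hp.out.ne_zero
  have hdiv' : ∀ X : geomPoints W, ∃ Y : geomPoints W, ((p ^ m : ℕ) : ℤ) • Y = X :=
    fun X => hdiv hnz X
  have hνm : ν ≤ m := by omega
  -- the class `g = κ_m(P)` and its two orders (files 66, 67)
  set g := kummerMapTorsion W ((p ^ m : ℕ) : ℤ) hdiv' P with hg
  have hgSel : g ∈ (W.kummerSelmerStructure ((p ^ m : ℕ) : ℤ) :
      SelmerStructure (W.torsionGaloisModule (p ^ m))).selmerGroup :=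
    RankOneKummerInputs.kummerMapTorsion_mem_selmerGroup_kummerSelmerStructure W _ hdiv' P
  have hgord : addOrderOf g = p ^ m :=
    RankOneKummerInputs.addOrderOf_kummerMapTorsion_eq W hm hdiv' P hord
  have hlocg : addOrderOf (galoisCohomology.localization (W.torsionGaloisModule ((p ^ m : ℕ) : ℤ))
      (Sum.inr w₀) 1 g) = p ^ (m - ν) :=
    LocalKummerOrder.addOrderOf_localization_kummerMapTorsion_eq W hνm hdiv' (Sum.inr w₀) htors P
      hPQ hexact
  -- (iii) from the `Ш`-exponent (file 66)
  have hSha' : ∀ s ∈ (W.kummerSelmerStructure ((p ^ m : ℕ) : ℤ) :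
      SelmerStructure (W.torsionGaloisModule (p ^ m))).selmerGroup,
      p ^ eSha • s ∈ AddSubgroup.zmultiples g := fun s hs =>
    RankOneKummerInputs.pow_nsmul_mem_zmultiples_kummerMapTorsion_selmerStructure W hdiv' P hgen
      hSha hs
  -- (iv) from the span (file 65)
  have hLD := KummerLineTransverseDual.kummer_inf_comap_dualLocalCondition_eq_bot W (p ^ m) e hμ
    hadd₁ hadd₂ hgal hnondeg inv hperf w₀ (hsd (Sum.inr w₀)) C hCL
  -- (v) from the killing hypothesis (file 64)
  have hidle := KummerLevelStabilisation.idle_local_conditions W p hdiv hΓ htν w₀ T hw₀T hkill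
    (fun w : ↥T => inv.dualTransported 𝓖 (weilDualIntertwining W (p ^ m) e hμ hadd₁ hadd₂ hgal)
      (Sum.inr (w : HeightOneSpectrum (𝓞 K)))) hgSel
  exact relIndex_mul_prime_pow_eq_card_mul_prod W (p ^ m) e hμ hadd₁ hadd₂ hgal hnondeg inv hperf hvan
    hcomp hS h𝓚 hsd hw₀ T hw₀T hT C hp.out rfl 𝓖 h𝓖v₀ h𝓖T h𝓖off hcount hgSel hgord hlocg hνm hSha'
    hLD het htν hidle.1 hidle.2

end Summit.BirchSwinnertonDyer.Rank1Residual.Additive.DefectCountFiniteLevel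

end
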